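import Mathlib
import HarnessLib

/-!
# Continuous induction ("bootstrap") on a time window (helper for the K_A♭ parent item
  stmt-NavierStokesRegularity-22987 `FlatGapCertificatesV2`, child 2A `GradedAdiabaticWakeA` of route TaoLadderRungTwoFlat;
  cell harvest/h2-tao-ladder, p1 g22; the joint per-hop `TubeStepCore` + `TubeStepNear` argument, LADDER §49.5, §50.3)

The joint per-hop estimate of the typed frame `H(n)` is circular at each instant of the hop: the co-moving energy
decay (`MirrorPulse.coMovingEnergyOn_decay_of_pseudoFlows`, near zone) needs an a-priori amplitude bound `A` on the block
with `2(1+ε)(A sinh(θ/2) + M(3+e^θ)) < σθ`; the amplitude bound comes from the energy budget outside the core window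
(`MirrorPulse.abs_le_of_energy_budget`), which needs the core to stay gauge-close to the pulse; the core closeness
(`QuadPolar.gauge_abs_le_forced_exp_Icc`) is driven by the interface forcing, i.e. by the near amplitude at the edge, i.e.
by the co-moving energy. Every link is continuous in time and strict at `t = 0`, so the loop closes by CONTINUOUS
INDUCTION. This file is that elementary tool, once and for all:

* `Icc_induction` — `f` continuous on `[0, T]`, `f 0 ≤ b < a`, and "`f ≤ a` on `[0, t]` ⇒ `f t ≤ b`" for every
  `t ∈ [0, T]`; then `f ≤ b` on `[0, T]` (the WEAK a-priori assumption `≤ a` on the past improves itself to the STRONG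
  conclusion `≤ b`; continuity bridges the gap `b < a` forward in time);
* `Icc_induction₂` — the same for two quantities at once (`f ≤ a₁ ∧ g ≤ a₂` on the past ⇒ `f t ≤ b₁ ∧ g t ≤ b₂`), the
  shape of the joint core/near bootstrap.

HONEST FRAMING: elementary real analysis (order topology of `ℝ`); nothing specific to any lattice; nothing about the
Navier–Stokes equations.
-/

noncomputable section

-- the sub-problem namespace repeats the summit name by design (D-0017)
set_option linter.dupNamespace false

namespace Summit.NavierStokesRegularity.NavierStokesRegularity.Theorems

namespace Bootstrap

open Set Filter Topology

/-- **CONTINUOUS INDUCTION ON `[0, T]`.** Let `f` be continuous on `[0, T]` (`T ≥ 0`), `f 0 ≤ b` with `b < a`, and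
suppose that for every `t ∈ [0, T]`, `f ≤ a` on `[0, t]` implies `f t ≤ b`. Then `f ≤ b` on `[0, T]`.
[folklore (the bootstrap / continuity argument); cell LADDER §49.5 (joint core–near loop)] -/
theorem Icc_induction {f : ℝ → ℝ} {T a b : ℝ} (hT : 0 ≤ T) (hf : ContinuousOn f (Icc 0 T))
    (hab : b < a) (h0 : f 0 ≤ b)
    (hstep : ∀ t ∈ Icc 0 T, (∀ s ∈ Icc 0 t, f s ≤ a) → f t ≤ b) :
    ∀ t ∈ Icc 0 T, f t ≤ b := by
  -- the HISTORY set: `f ≤ b` on `[0, min(·, T)]`, written with `min` so that it is visibly closed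
  set H : Set ℝ := {t | ∀ s ∈ Icc 0 T, f (min s t) ≤ b} with hH
  have hmain : Icc 0 T ⊆ H := by
    apply IsClosed.Icc_subset_of_forall_mem_nhdsWithin
    · -- `H ∩ [0, T]` is closed: an intersection of preimages under `t ↦ f (min s t)`, continuous on `[0, T]`
      have hrepr : H ∩ Icc 0 T = ⋂ s ∈ Icc 0 T, (Icc 0 T ∩ (fun t => f (min s t)) ⁻¹' Iic b) := by
        ext t
        simp only [hH, mem_inter_iff, mem_setOf_eq, mem_iInter, mem_preimage, mem_Iic]
        constructor
        · rintro ⟨h1, h2⟩ s hs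
          exact ⟨h2, h1 s hs⟩
        · intro h
          exact ⟨fun s hs => (h s hs).2, (h 0 (left_mem_Icc.mpr hT)).1⟩
      rw [hrepr]
      refine isClosed_biInter fun s hs => ?_
      have hc : ContinuousOn (fun t => f (min s t)) (Icc 0 T) := by
        refine hf.comp (continuous_const.min continuous_id).continuousOn ?_
        intro t ht
        exact ⟨le_min hs.1 ht.1, (min_le_right s t).trans ht.2⟩
      exact hc.preimage_isClosed_of_isClosed isClosed_Icc isClosed_Iic
    · -- `0 ∈ H`
      intro s hs
      rw [min_eq_right hs.1]
      exact h0
    · -- right-openness: from a history point `x < T`, continuity pushes `f < a` a bit further, and the step closes it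
      rintro x ⟨hxH, hx⟩
      have hist : ∀ s ∈ Icc 0 x, f s ≤ b := by
        intro s hs
        have h := hxH s ⟨hs.1, hs.2.trans hx.2.le⟩
        rwa [min_eq_left hs.2] at h
      have hxT : x ∈ Icc 0 T := ⟨hx.1, hx.2.le⟩
      have hfx : f x < a := lt_of_le_of_lt (hist x ⟨hx.1, le_rfl⟩) hab
      have hev : ∀ᶠ t in 𝓝[Icc 0 T] x, f t < a := (hf x hxT).eventually (gt_mem_nhds hfx)
      rw [eventually_nhdsWithin_iff, Metric.eventually_nhds_iff] at hev
      obtain ⟨η, hη, hηa⟩ := hev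
      rw [mem_nhdsGT_iff_exists_Ioo_subset]
      refine ⟨min T (x + η), lt_min hx.2 (by linarith), fun t ht => ?_⟩
      have htT : t ≤ T := (ht.2.trans_le (min_le_left _ _)).le
      have htη : t < x + η := ht.2.trans_le (min_le_right _ _)
      have hxt : x < t := ht.1
      -- `f ≤ a` on `[0, t]`
      have hle_a : ∀ s ∈ Icc 0 t, f s ≤ a := by
        intro s hs
        by_cases hsx : s ≤ x
        · exact (hist s ⟨hs.1, hsx⟩).trans hab.le
        · rw [not_le] at hsx
          have hsT : s ∈ Icc 0 T := ⟨hs.1, hs.2.trans htT⟩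
          have hdist : dist s x < η := by
            rw [Real.dist_eq, abs_of_pos (by linarith)]
            linarith [hs.2]
          exact (hηa hdist hsT).le
      -- hence `f ≤ b` on `[0, t]` by the step, i.e. `t ∈ H`
      intro s hs
      have hm0 : 0 ≤ min s t := le_min hs.1 (hx.1.trans hxt.le)
      have hmt : min s t ≤ t := min_le_right _ _
      exact hstep (min s t) ⟨hm0, hmt.trans htT⟩ fun s' hs' => hle_a s' ⟨hs'.1, hs'.2.trans hmt⟩
  intro t ht
  have h := hmain ht t ht
  rwa [min_self] at h

/-- **CONTINUOUS INDUCTION FOR TWO QUANTITIES.** `f, g` continuous on `[0, T]`, `f 0 ≤ b₁ < a₁`, `g 0 ≤ b₂ < a₂`, and for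
every `t ∈ [0, T]`: `f ≤ a₁` and `g ≤ a₂` on `[0, t]` imply `f t ≤ b₁` and `g t ≤ b₂`. Then `f ≤ b₁` and `g ≤ b₂` on
`[0, T]`. (Reduction to `Icc_induction` for `max (f − b₁)/(a₁ − b₁), (g − b₂)/(a₂ − b₂)`, done directly.)
[folklore (the bootstrap / continuity argument); cell LADDER §49.5 (joint core–near loop)] -/
theorem Icc_induction₂ {f g : ℝ → ℝ} {T a₁ b₁ a₂ b₂ : ℝ} (hT : 0 ≤ T)
    (hf : ContinuousOn f (Icc 0 T)) (hg : ContinuousOn g (Icc 0 T))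
    (hab₁ : b₁ < a₁) (hab₂ : b₂ < a₂) (hf0 : f 0 ≤ b₁) (hg0 : g 0 ≤ b₂)
    (hstep : ∀ t ∈ Icc 0 T, (∀ s ∈ Icc 0 t, f s ≤ a₁ ∧ g s ≤ a₂) → f t ≤ b₁ ∧ g t ≤ b₂) :
    ∀ t ∈ Icc 0 T, f t ≤ b₁ ∧ g t ≤ b₂ := by
  -- normalised gap functions: `F = (f − b₁)/(a₁ − b₁)`, `G = (g − b₂)/(a₂ − b₂)`; induct on `max F G` with `b = 0 < a = 1`
  have hd₁ : 0 < a₁ - b₁ := sub_pos.mpr hab₁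
  have hd₂ : 0 < a₂ - b₂ := sub_pos.mpr hab₂
  set h : ℝ → ℝ := fun t => max ((f t - b₁) / (a₁ - b₁)) ((g t - b₂) / (a₂ - b₂)) with hh
  have h1 : ContinuousOn (fun t => (f t - b₁) / (a₁ - b₁)) (Icc 0 T) := (hf.sub continuousOn_const).div_const _
  have h2 : ContinuousOn (fun t => (g t - b₂) / (a₂ - b₂)) (Icc 0 T) := (hg.sub continuousOn_const).div_const _
  have hhc : ContinuousOn h (Icc 0 T) := ContinuousOn.sup h1 h2
  -- dictionary between `h` and the pair
  have hle_iff : ∀ t, h t ≤ 0 ↔ f t ≤ b₁ ∧ g t ≤ b₂ := by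
    intro t
    simp only [hh, max_le_iff, div_le_iff₀ hd₁, div_le_iff₀ hd₂, zero_mul, sub_nonpos]
  have hle_one : ∀ t, h t ≤ 1 → f t ≤ a₁ ∧ g t ≤ a₂ := by
    intro t ht1
    simp only [hh, max_le_iff, div_le_iff₀ hd₁, div_le_iff₀ hd₂, one_mul] at ht1
    constructor <;> linarith [ht1.1, ht1.2]
  have hres := Icc_induction (f := h) (a := 1) (b := 0) hT hhc one_pos ((hle_iff 0).mpr ⟨hf0, hg0⟩)
    (fun t ht hpast => (hle_iff t).mpr (hstep t ht fun s hs => hle_one s (hpast s hs)))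
  exact fun t ht => (hle_iff t).mp (hres t ht)

end Bootstrap

end Summit.NavierStokesRegularity.NavierStokesRegularity.Theorems

end
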